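import Summits.QuantumFields.YangMills.Theses.UnitScaleTilt
import Literature.MathematicalPhysics.QuantumFieldTheory.Balaban1983to89.T3PrintedRegularMinimiser

/-!
# LINE for K1 `UnitTilt` (stmt-QuantumFields-18915) over the minimum on PRINT'S TWO-CLAUSE regular space — parent skeleton of the
# children-v3 resplit (plan g8 ruling R2; supersedes p1 g4's `UV3-K1RegLineSketch.lean` whose stubs were the plaquette-only `…RegAt` twins)

Cell `ym3-torus`, seat ym3-torus-plan g8.  Two stubs = the two children of record under the resplit (statements of
HOME/route-R3/ym/reshape-pr/children-v3.json 50dc478890b31e08 token for token), composition PROVED by the tree theorem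
`T3PrintedRegularMinimiser.unitTilt_shape_of_regPr` (p415317 ACCEPTED 47d33c95bc16) — the same term the route's `--glue-by`
`Summit.QuantumFields.YangMills.Theorems.unitScaleTilt_unitTilt_of_regPr` wraps.  Prefix of both stubs:
`∀ L, ∃ ε₁ > 0, ∀ ε₀ ∈ (0, ε₁], ∃ m₀, ∀ m ≥ m₀, ∀ profile (0 < b₀, 2 < p₀), ∃ γ₁ > 0, ∀ F γ (F.L = L, 0 < γ ≤ γ₁)`.
* `stub_minimiserRegPr`   — `MinimiserStabilityRegPrAt F γ b₀ p₀ m ε₀`   (K1aR-pr: E-min at the minimum over (6) of [Balaban1985Variational],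
  BOTH clauses incl. the covariant-divergence clause [Balaban1985RegularSpaces] (1.9); EXIST = Thm 1 p.279 + p.281 l.19–21 modulo the averaging port)
* `stub_fluctuationRegPr` — `FluctuationComparisonRegPrAt F γ b₀ p₀ m ε₀` (K1bR-pr: two-run stability of (41)'s Σ𝒫_j + R at that background)
Neither stub contains a «global infimum vs regular minimum» question (G-K1a-1(b)) nor the v2 gap G-K1aR-1 (`RegInfAgreeAt`).
-/

noncomputable section

open Literature.MathematicalPhysics.QuantumFieldTheory.Balaban1983to89
open Literature.MathematicalPhysics.QuantumFieldTheory.Balaban1983to89.T3ContinuumYM3Torus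
open Literature.MathematicalPhysics.QuantumFieldTheory.Balaban1983to89.T3PrintedRegularMinimiser
open Summit.QuantumFields.YangMills.Theses.UnitScaleTilt

namespace Summit.QuantumFields.YangMills.Theses.UnitScaleTilt.K1PrintedRegularBackground

/-- stub A (K1aR-pr = child `MinimiserStabilityRegPr` verbatim): minimiser stability at print's regular background, for all small ε₀,
eventually in m, below γ₁(ε₀,…). [cite: Balaban1985Variational, Thm 1 (8) p.279] -/
theorem stub_minimiserRegPr : ∀ (L : ℕ), ∃ ε₁ : ℝ, 0 < ε₁ ∧ ∀ (ε₀ : ℝ), 0 < ε₀ → ε₀ ≤ ε₁ → ∃ m₀ : ℕ, ∀ (m : ℕ), m₀ ≤ m →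
    ∀ (b₀ p₀ : ℝ), 0 < b₀ → 2 < p₀ → ∃ γ₁ : ℝ, 0 < γ₁ ∧ ∀ (F : T3Family) (γ : ℝ), F.L = L → 0 < γ → γ ≤ γ₁ →
      MinimiserStabilityRegPrAt F γ b₀ p₀ m ε₀ := by
  sorry

/-- stub B (K1bR-pr = child `FluctuationComparisonRegPr` verbatim): fluctuation comparison at print's regular background, same prefix.
[cite: Balaban1988LargeFieldII, (41) p.372] -/
theorem stub_fluctuationRegPr : ∀ (L : ℕ), ∃ ε₁ : ℝ, 0 < ε₁ ∧ ∀ (ε₀ : ℝ), 0 < ε₀ → ε₀ ≤ ε₁ → ∃ m₀ : ℕ, ∀ (m : ℕ), m₀ ≤ m →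
    ∀ (b₀ p₀ : ℝ), 0 < b₀ → 2 < p₀ → ∃ γ₁ : ℝ, 0 < γ₁ ∧ ∀ (F : T3Family) (γ : ℝ), F.L = L → 0 < γ → γ ≤ γ₁ →
      FluctuationComparisonRegPrAt F γ b₀ p₀ m ε₀ := by
  sorry

/-- COMPOSITION (proved, by the tree glue `unitTilt_shape_of_regPr`): the two stubs ⇒ K1 BY NAME. -/
theorem UnitTilt_of : UnitTilt := fun L => unitTilt_shape_of_regPr L (stub_minimiserRegPr L) (stub_fluctuationRegPr L)

end Summit.QuantumFields.YangMills.Theses.UnitScaleTilt.K1PrintedRegularBackground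

end
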